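import Mathlib.LinearAlgebra.Matrix.Block
import Mathlib.LinearAlgebra.Matrix.Permutation
import Mathlib.Algebra.Order.Chebyshev
import Mathlib.Data.Real.Basic
import HarnessLib

/-!
# Quality of a set of hint vectors (BLPRS 2013, Def. 4.5) and `{0,1}ᵐ` has quality 2 (Claim 4.6)

Topic `Computability/Cryptography`, grouping namespace `BLPRS2013` (the glue namespace of
`BLPRSReduction.lean`). Proved material (no named fact is introduced) towards the named fact
`Literature.Computability.Cryptography.blprs_gapSVP_sqrt_dim_to_lwe_classical` (**pqc.S21**;
Brakerski–Langlois–Peikert–Regev–Stehlé, STOC 2013, Thm. 1.1): the combinatorial input of the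
`extLWE` reduction, Lemma 4.7 (a component of hypothesis `h₃` of `BLPRSReduction.lean`).

> **Definition 4.5.** For a real `ξ > 0` and a set `𝒵 ⊆ ℤᵐ` we say that `𝒵` is of quality `ξ` if given
> any `z ∈ 𝒵`, we can efficiently find a unimodular matrix `U ∈ ℤ^{m×m}` such that if
> `U' ∈ ℤ^{m×(m-1)}` is the matrix obtained from `U` by removing its leftmost column then all of the
> columns of `U'` are orthogonal to `z` and its largest singular value is at most `ξ`.
>
> **Claim 4.6.** The set `𝒵 = {0,1}ᵐ` is of quality `2`.
>
> *Proof.* Let `z ∈ 𝒵` and assume without loss of generality that its first `k ≥ 1` coordinates are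
> `1` and the remaining `m - k` are `0`. Then consider the upper bidiagonal matrix `U` whose diagonal
> is all `1`s and whose diagonal above the main diagonal is `(-1, …, -1, 0, …, 0)` with `-1` appearing
> `k - 1` times. The matrix is clearly unimodular and all the columns except the first one are
> orthogonal to `z`. Moreover, by the triangle inequality, we can bound the operator norm of `U` by the
> sum of that of the diagonal `1` matrix and the off-diagonal matrix, both of which clearly have norm
> at most `1`.

## Results

* `HasQuality ξ 𝒵` — Def. 4.5, with "largest singular value of `U'` at most `ξ`" written as the
  operator-norm inequality `‖U x‖₂ ≤ ξ ‖x‖₂` for all real `x` vanishing at the removed coordinate `0`,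
  in sum-of-squares form (`∑ᵢ (∑ⱼ Uᵢⱼ xⱼ)² ≤ ξ² ∑ⱼ xⱼ²`); "efficiently find" is existence here (the
  matrix is explicit: `qualityMatrix`).
* `qualityMatrix z` — the printed matrix for a GENERAL binary `z` (no "without loss of generality"):
  with `S = supp z`, `i₁ = min S` and `pred c` the predecessor of `c` in `S`, the unitriangular
  `V = 1 + N`, `N_{pred c, c} = -1` for `c ∈ S ∖ {i₁}` (column `c` of `V` is `e_c - e_{pred c}` on
  `S ∖ {i₁}`, `e_c` elsewhere), followed by the column swap `0 ↔ i₁` moving the one non-orthogonal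
  column `e_{i₁}` to the left (for sorted `z` this is the printed bidiagonal matrix);
* `det_qualityCore` (`det V = 1`), `isUnit_det_qualityMatrix` (`det U = ±1`),
  `col_qualityMatrix_dotProduct` (columns `j ≠ 0` orthogonal to `z`), `sum_sq_qualityCore_mulVec_le`
  (`‖V y‖² ≤ 4‖y‖²`: `‖N y‖ ≤ ‖y‖` since `N` has at most one `-1` per row and per column, then the
  triangle inequality via Cauchy–Schwarz), and **`hasQuality_two_binary`** — Claim 4.6.

## References

* Z. Brakerski, A. Langlois, C. Peikert, O. Regev, D. Stehlé, *Classical hardness of learning with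
  errors*, STOC 2013; arXiv:1306.0281, §4.2, Def. 4.5 and Claim 4.6 with its proof.
-/

namespace Literature.Computability.Cryptography

namespace BLPRS2013

open Matrix Finset

variable {m : ℕ}

/-! ### Definition 4.5 -/

/-- **BLPRS Def. 4.5 (quality of a set of hint vectors).** `𝒵 ⊆ ℤᵐ` has quality `ξ` if for every
`z ∈ 𝒵` there is a unimodular `U ∈ ℤ^{m×m}` (`det U = ±1`) whose columns other than the leftmost one
(index `0`) are orthogonal to `z` and such that `U'` (= `U` without its leftmost column) has largest
singular value at most `ξ`, i.e. `‖U x‖₂ ≤ ξ ‖x‖₂` for every real `x` with `x₀ = 0` — written in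
sum-of-squares form. (Printed: "we can efficiently find" such a `U`; existence is what the
correctness of Lemma 4.7 uses, efficiency belongs to the machine.) [cite: BrakerskiEtAl2013, Def. 4.5] -/
def HasQuality [NeZero m] (ξ : ℝ) (Z : Set (Fin m → ℤ)) : Prop :=
  ∀ z ∈ Z, ∃ U : Matrix (Fin m) (Fin m) ℤ, IsUnit U.det ∧
    (∀ j : Fin m, j ≠ 0 → (fun i => U i j) ⬝ᵥ z = 0) ∧
    ∀ x : Fin m → ℝ, x 0 = 0 → ∑ i, (∑ j, (U i j : ℝ) * x j) ^ 2 ≤ ξ ^ 2 * ∑ j, x j ^ 2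

/-! ### The matrix of Claim 4.6 for a general binary vector -/

/-- The support of `z` (coordinates equal to `1`). [folklore] -/
def supp (z : Fin m → ℤ) : Finset (Fin m) := Finset.univ.filter fun i => z i = 1

/-- The predecessor of `c` inside a finite set `S` (the largest element of `S` below `c`), or `c` itself
if there is none. [folklore] -/
noncomputable def predIn (S : Finset (Fin m)) (c : Fin m) : Fin m :=
  if h : (S.filter fun i => i < c).Nonempty then (S.filter fun i => i < c).max' h else c

/-- The predecessor is strictly smaller when it exists. [folklore] -/
theorem predIn_lt {S : Finset (Fin m)} {c : Fin m} (h : (S.filter fun i => i < c).Nonempty) :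
    predIn S c < c := by
  rw [predIn, dif_pos h]
  exact (Finset.mem_filter.1 (Finset.max'_mem _ h)).2

/-- The predecessor lies in `S` when it exists. [folklore] -/
theorem predIn_mem {S : Finset (Fin m)} {c : Fin m} (h : (S.filter fun i => i < c).Nonempty) :
    predIn S c ∈ S := by
  rw [predIn, dif_pos h]
  exact (Finset.mem_filter.1 (Finset.max'_mem _ h)).1

/-- Every element of `S` below `c` is at most the predecessor of `c`. [folklore] -/
theorem le_predIn {S : Finset (Fin m)} {c i : Fin m} (hi : i ∈ S) (hic : i < c) : i ≤ predIn S c := by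
  have h : (S.filter fun i => i < c).Nonempty := ⟨i, Finset.mem_filter.2 ⟨hi, hic⟩⟩
  rw [predIn, dif_pos h]
  exact Finset.le_max' _ _ (Finset.mem_filter.2 ⟨hi, hic⟩)

/-- Elements of `S` other than its minimum have a predecessor. [folklore] -/
theorem filter_lt_nonempty {S : Finset (Fin m)} (hS : S.Nonempty) {c : Fin m} (hc : c ∈ S)
    (hne : c ≠ S.min' hS) : (S.filter fun i => i < c).Nonempty :=
  ⟨S.min' hS, Finset.mem_filter.2 ⟨Finset.min'_mem _ _, lt_of_le_of_ne (Finset.min'_le _ _ hc) (Ne.symm hne)⟩⟩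

/-- The predecessor map is injective on `S` minus its minimum. [folklore] -/
theorem predIn_injOn {S : Finset (Fin m)} (hS : S.Nonempty) {c c' : Fin m} (hc : c ∈ S) (hc' : c' ∈ S)
    (hne : c ≠ S.min' hS) (hne' : c' ≠ S.min' hS) (h : predIn S c = predIn S c') : c = c' := by
  by_contra hcc
  rcases lt_or_gt_of_ne hcc with hlt | hlt
  · have h1 : c ≤ predIn S c' := le_predIn hc hlt
    have h2 : predIn S c < c := predIn_lt (filter_lt_nonempty hS hc hne)
    rw [h] at h2
    exact absurd (lt_of_le_of_lt h1 h2) (lt_irrefl _)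
  · have h1 : c' ≤ predIn S c := le_predIn hc' hlt
    have h2 : predIn S c' < c' := predIn_lt (filter_lt_nonempty hS hc' hne')
    rw [← h] at h2
    exact absurd (lt_of_le_of_lt h1 h2) (lt_irrefl _)

/-- The off-diagonal part `N` of the core matrix for support `S` with minimum excluded:
`N_{r,c} = -1` iff `c ∈ S`, `c ≠ min S` and `r = pred c`. [cite: BrakerskiEtAl2013, Claim 4.6 (proof: "the off-diagonal matrix")] -/
noncomputable def offDiag (S : Finset (Fin m)) (hS : S.Nonempty) : Matrix (Fin m) (Fin m) ℤ :=
  fun r c => if c ∈ S ∧ c ≠ S.min' hS ∧ r = predIn S c then -1 else 0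

/-- The core matrix `V = 1 + N` (upper unitriangular; for `S = {0, …, k-1}` the printed upper
bidiagonal matrix). [cite: BrakerskiEtAl2013, Claim 4.6 (proof)] -/
noncomputable def qualityCore (S : Finset (Fin m)) (hS : S.Nonempty) : Matrix (Fin m) (Fin m) ℤ :=
  1 + offDiag S hS

/-- `N` vanishes on and below the diagonal. [folklore] -/
theorem offDiag_eq_zero_of_le {S : Finset (Fin m)} (hS : S.Nonempty) {r c : Fin m} (h : c ≤ r) :
    offDiag S hS r c = 0 := by
  rw [offDiag]
  split_ifs with hcond
  · obtain ⟨hc, hne, rfl⟩ := hcond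
    exact absurd (predIn_lt (filter_lt_nonempty hS hc hne)) (not_lt.2 h)
  · rfl

/-- `det V = 1` (upper unitriangular). [cite: BrakerskiEtAl2013, Claim 4.6 (proof: "clearly unimodular")] -/
theorem det_qualityCore {S : Finset (Fin m)} (hS : S.Nonempty) : (qualityCore S hS).det = 1 := by
  rw [qualityCore, det_of_upperTriangular]
  · refine Finset.prod_eq_one fun i _ => ?_
    rw [Matrix.add_apply, Matrix.one_apply_eq, offDiag_eq_zero_of_le hS le_rfl, add_zero]
  · intro r c hcr
    have hcr' : c < r := hcr
    rw [Matrix.add_apply, Matrix.one_apply_ne (ne_of_gt hcr'), offDiag_eq_zero_of_le hS hcr'.le, add_zero]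

/-- **Columns of `V` other than `e_{min S}` are orthogonal to `1_S`**: column `c` is `e_c - e_{pred c}`
for `c ∈ S ∖ {min S}` (`1 - 1 = 0`) and `e_c` for `c ∉ S` (`0`). [cite: BrakerskiEtAl2013, Claim 4.6 (proof: "all the columns except the first one are orthogonal to z")] -/
theorem col_qualityCore_dotProduct {S : Finset (Fin m)} (hS : S.Nonempty) {z : Fin m → ℤ}
    (hz : ∀ i, z i = if i ∈ S then 1 else 0) {c : Fin m} (hc : c ≠ S.min' hS) :
    (fun i => qualityCore S hS i c) ⬝ᵥ z = 0 := by
  classical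
  have hsplit : (fun i => qualityCore S hS i c) ⬝ᵥ z = z c + ∑ i, offDiag S hS i c * z i := by
    simp only [dotProduct, qualityCore, Matrix.add_apply, add_mul, Finset.sum_add_distrib]
    congr 1
    rw [Finset.sum_eq_single c]
    · rw [Matrix.one_apply_eq, one_mul]
    · intro i _ hic
      rw [Matrix.one_apply_ne hic, zero_mul]
    · exact fun h => absurd (Finset.mem_univ c) h
  rw [hsplit]
  by_cases hcS : c ∈ S
  · -- `c ∈ S`, `c ≠ min S`: the column is `e_c - e_{pred c}`
    have hsum : ∑ i, offDiag S hS i c * z i = -z (predIn S c) := by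
      rw [Finset.sum_eq_single (predIn S c)]
      · rw [offDiag, if_pos ⟨hcS, hc, rfl⟩, neg_one_mul]
      · intro i _ hi
        rw [offDiag, if_neg (fun h => hi h.2.2), zero_mul]
      · exact fun h => absurd (Finset.mem_univ _) h
    rw [hsum, hz c, if_pos hcS, hz (predIn S c), if_pos (predIn_mem (filter_lt_nonempty hS hcS hc))]
    ring
  · -- `c ∉ S`: the column is `e_c`
    have hsum : ∑ i, offDiag S hS i c * z i = 0 :=
      Finset.sum_eq_zero fun i _ => by rw [offDiag, if_neg (fun h => hcS h.1), zero_mul]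
    rw [hsum, hz c, if_neg hcS, add_zero]

/-- **`‖N y‖² ≤ ‖y‖²`**: row `r` of `N` has at most one entry `-1` (at the unique `c` with
`pred c = r`), so `‖N y‖² = ∑_{c ∈ S ∖ {min S}} y_c²`. [cite: BrakerskiEtAl2013, Claim 4.6 (proof: "the off-diagonal matrix … norm at most 1")] -/
theorem sum_sq_offDiag_mulVec_le {S : Finset (Fin m)} (hS : S.Nonempty) (y : Fin m → ℝ) :
    ∑ r, (∑ c, (offDiag S hS r c : ℝ) * y c) ^ 2 ≤ ∑ c, y c ^ 2 := by
  classical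
  set S' := S.filter fun c => c ≠ S.min' hS with hS'
  -- row `r`: the sum over the fibre of `pred` above `r`
  have hrow : ∀ r, ∑ c, (offDiag S hS r c : ℝ) * y c = -∑ c ∈ S'.filter (fun c => predIn S c = r), y c := by
    intro r
    rw [← Finset.sum_neg_distrib, ← Finset.sum_filter_add_sum_filter_not Finset.univ
      (fun c => c ∈ S ∧ c ≠ S.min' hS ∧ r = predIn S c)]
    have h0 : ∑ c ∈ Finset.univ.filter (fun c => ¬ (c ∈ S ∧ c ≠ S.min' hS ∧ r = predIn S c)),
        (offDiag S hS r c : ℝ) * y c = 0 :=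
      Finset.sum_eq_zero fun c hc => by
        rw [offDiag, if_neg (Finset.mem_filter.1 hc).2, Int.cast_zero, zero_mul]
    rw [h0, add_zero]
    have hset : Finset.univ.filter (fun c => c ∈ S ∧ c ≠ S.min' hS ∧ r = predIn S c) =
        S'.filter (fun c => predIn S c = r) := by
      ext c
      simp only [hS', Finset.mem_filter, Finset.mem_univ, true_and]
      constructor
      · rintro ⟨h1, h2, h3⟩; exact ⟨⟨h1, h2⟩, h3.symm⟩
      · rintro ⟨⟨h1, h2⟩, h3⟩; exact ⟨h1, h2, h3.symm⟩
    rw [hset]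
    refine Finset.sum_congr rfl fun c hc => ?_
    rw [offDiag, if_pos ⟨(Finset.mem_filter.1 (Finset.mem_filter.1 hc).1).1,
      (Finset.mem_filter.1 (Finset.mem_filter.1 hc).1).2, (Finset.mem_filter.1 hc).2.symm⟩]
    push_cast
    ring
  -- each fibre has at most one element
  have hcard : ∀ r, (S'.filter (fun c => predIn S c = r)).card ≤ 1 := by
    intro r
    refine Finset.card_le_one.2 fun c hc c' hc' => ?_
    have h1 := Finset.mem_filter.1 hc
    have h2 := Finset.mem_filter.1 hc'
    have h1' := Finset.mem_filter.1 h1.1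
    have h2' := Finset.mem_filter.1 h2.1
    exact predIn_injOn hS h1'.1 h2'.1 h1'.2 h2'.2 (h1.2.trans h2.2.symm)
  calc ∑ r, (∑ c, (offDiag S hS r c : ℝ) * y c) ^ 2
      = ∑ r, (∑ c ∈ S'.filter (fun c => predIn S c = r), y c) ^ 2 := by
        refine Finset.sum_congr rfl fun r _ => ?_
        rw [hrow, neg_sq]
    _ ≤ ∑ r, ∑ c ∈ S'.filter (fun c => predIn S c = r), y c ^ 2 := by
        refine Finset.sum_le_sum fun r _ => ?_
        refine (sq_sum_le_card_mul_sum_sq (s := S'.filter (fun c => predIn S c = r)) (f := y)).trans ?_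
        have hc1 : ((S'.filter (fun c => predIn S c = r)).card : ℝ) ≤ 1 := by exact_mod_cast hcard r
        have hnn : 0 ≤ ∑ c ∈ S'.filter (fun c => predIn S c = r), y c ^ 2 :=
          Finset.sum_nonneg fun c _ => sq_nonneg _
        nlinarith
    _ = ∑ c ∈ S', y c ^ 2 := Finset.sum_fiberwise S' (predIn S) fun c => y c ^ 2
    _ ≤ ∑ c, y c ^ 2 :=
        Finset.sum_le_sum_of_subset_of_nonneg (Finset.subset_univ _) fun c _ _ => sq_nonneg _

/-- **`‖V y‖² ≤ 4 ‖y‖²`** ("by the triangle inequality, we can bound the operator norm of `U` by the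
sum of that of the diagonal `1` matrix and the off-diagonal matrix, both of which clearly have norm
at most `1`"; here via Cauchy–Schwarz in sum-of-squares form). [cite: BrakerskiEtAl2013, Claim 4.6 (proof)] -/
theorem sum_sq_qualityCore_mulVec_le {S : Finset (Fin m)} (hS : S.Nonempty) (y : Fin m → ℝ) :
    ∑ r, (∑ c, (qualityCore S hS r c : ℝ) * y c) ^ 2 ≤ 2 ^ 2 * ∑ c, y c ^ 2 := by
  classical
  set w : Fin m → ℝ := fun r => ∑ c, (offDiag S hS r c : ℝ) * y c with hw
  have hV : ∀ r, ∑ c, (qualityCore S hS r c : ℝ) * y c = y r + w r := by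
    intro r
    simp only [hw, qualityCore, Matrix.add_apply, Int.cast_add, add_mul, Finset.sum_add_distrib]
    congr 1
    rw [Finset.sum_eq_single r]
    · rw [Matrix.one_apply_eq, Int.cast_one, one_mul]
    · intro c _ hcr
      rw [Matrix.one_apply_ne (Ne.symm hcr), Int.cast_zero, zero_mul]
    · exact fun h => absurd (Finset.mem_univ r) h
  have hw2 : ∑ r, w r ^ 2 ≤ ∑ r, y r ^ 2 := sum_sq_offDiag_mulVec_le hS y
  -- Cauchy–Schwarz: `∑ y w ≤ √(∑ y²) √(∑ w²) ≤ ∑ y²`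
  have hCS : (∑ r, y r * w r) ^ 2 ≤ (∑ r, y r ^ 2) * (∑ r, w r ^ 2) :=
    Finset.sum_mul_sq_le_sq_mul_sq Finset.univ y w
  have hy0 : 0 ≤ ∑ r, y r ^ 2 := Finset.sum_nonneg fun r _ => sq_nonneg _
  have hyw : ∑ r, y r * w r ≤ ∑ r, y r ^ 2 := by
    have h1 : (∑ r, y r * w r) ^ 2 ≤ (∑ r, y r ^ 2) ^ 2 := by
      calc (∑ r, y r * w r) ^ 2 ≤ (∑ r, y r ^ 2) * (∑ r, w r ^ 2) := hCS
        _ ≤ (∑ r, y r ^ 2) * (∑ r, y r ^ 2) := mul_le_mul_of_nonneg_left hw2 hy0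
        _ = (∑ r, y r ^ 2) ^ 2 := by ring
    exact (abs_le_of_sq_le_sq' h1 hy0).2
  have hexp : ∀ r, (y r + w r) ^ 2 = y r ^ 2 + 2 * (y r * w r) + w r ^ 2 := fun r => by ring
  calc ∑ r, (∑ c, (qualityCore S hS r c : ℝ) * y c) ^ 2 = ∑ r, (y r + w r) ^ 2 :=
        Finset.sum_congr rfl fun r _ => by rw [hV r]
    _ = ∑ r, y r ^ 2 + 2 * ∑ r, y r * w r + ∑ r, w r ^ 2 := by
        simp_rw [hexp, Finset.sum_add_distrib, ← Finset.mul_sum]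
    _ ≤ 2 ^ 2 * ∑ c, y c ^ 2 := by nlinarith

/-! ### Claim 4.6 -/

/-- **The matrix of Claim 4.6 for a binary `z`**: the identity if `z = 0`; otherwise the core matrix of
`supp z` with its columns `0` and `min (supp z)` swapped, so that the one column not orthogonal to
`z` (namely `e_{min (supp z)}`) is the leftmost. For `z = (1, …, 1, 0, …, 0)` this is the printed
upper bidiagonal matrix. [cite: BrakerskiEtAl2013, Claim 4.6 (proof)] -/
noncomputable def qualityMatrix [NeZero m] (z : Fin m → ℤ) : Matrix (Fin m) (Fin m) ℤ :=
  if hS : (supp z).Nonempty then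
    (qualityCore (supp z) hS).submatrix id (Equiv.swap 0 ((supp z).min' hS))
  else 1

/-- A binary vector is the indicator of its support. [folklore] -/
theorem eq_ite_mem_supp {z : Fin m → ℤ} (hz : ∀ i, z i = 0 ∨ z i = 1) (i : Fin m) :
    z i = if i ∈ supp z then 1 else 0 := by
  rcases hz i with h | h
  · rw [if_neg, h]
    intro hi
    have := (Finset.mem_filter.1 hi).2
    omega
  · have hi : i ∈ supp z := Finset.mem_filter.2 ⟨Finset.mem_univ _, h⟩
    rw [if_pos hi, h]

/-- A binary vector with empty support is `0`. [folklore] -/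
theorem eq_zero_of_supp_not_nonempty {z : Fin m → ℤ} (hz : ∀ i, z i = 0 ∨ z i = 1)
    (hS : ¬ (supp z).Nonempty) : z = 0 := by
  funext i
  rw [eq_ite_mem_supp hz i, if_neg (fun hi => hS ⟨i, hi⟩)]
  rfl

/-- `det U = ±1` (a column permutation of a unitriangular matrix). [cite: BrakerskiEtAl2013, Claim 4.6 (proof: "clearly unimodular")] -/
theorem isUnit_det_qualityMatrix [NeZero m] (z : Fin m → ℤ) : IsUnit (qualityMatrix z).det := by
  rw [qualityMatrix]
  split_ifs with hS
  · rw [det_permute', det_qualityCore, mul_one]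
    exact Units.isUnit _
  · rw [det_one]
    exact isUnit_one

/-- **All columns of `U` except the leftmost are orthogonal to `z`.** [cite: BrakerskiEtAl2013, Claim 4.6 (proof)] -/
theorem col_qualityMatrix_dotProduct [NeZero m] {z : Fin m → ℤ} (hz : ∀ i, z i = 0 ∨ z i = 1)
    {j : Fin m} (hj : j ≠ 0) : (fun i => qualityMatrix z i j) ⬝ᵥ z = 0 := by
  rw [qualityMatrix]
  split_ifs with hS
  · simp only [Matrix.submatrix_apply, id_eq]
    refine col_qualityCore_dotProduct hS (eq_ite_mem_supp hz) fun h => hj ?_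
    refine (Equiv.swap (0 : Fin m) ((supp z).min' hS)).injective ?_
    rw [h, Equiv.swap_apply_left]
  · rw [eq_zero_of_supp_not_nonempty hz hS, dotProduct_zero]

/-- **`‖U x‖² ≤ 4 ‖x‖²` for every real `x`** (so in particular the operator norm of `U'` is at most `2`).
[cite: BrakerskiEtAl2013, Claim 4.6 (proof)] -/
theorem sum_sq_qualityMatrix_mulVec_le [NeZero m] (z : Fin m → ℤ) (x : Fin m → ℝ) :
    ∑ i, (∑ j, (qualityMatrix z i j : ℝ) * x j) ^ 2 ≤ 2 ^ 2 * ∑ j, x j ^ 2 := by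
  rw [qualityMatrix]
  split_ifs with hS
  · set σ := Equiv.swap (0 : Fin m) ((supp z).min' hS) with hσ
    have hreindex : ∀ i, ∑ j, ((qualityCore (supp z) hS).submatrix id σ i j : ℝ) * x j =
        ∑ c, (qualityCore (supp z) hS i c : ℝ) * x (σ c) := by
      intro i
      simp only [Matrix.submatrix_apply, id_eq]
      rw [← Equiv.sum_comp σ (fun j => ((qualityCore (supp z) hS) i (σ j) : ℝ) * x j)]
      refine Finset.sum_congr rfl fun c _ => ?_
      rw [hσ, Equiv.swap_apply_self]
    calc ∑ i, (∑ j, ((qualityCore (supp z) hS).submatrix id σ i j : ℝ) * x j) ^ 2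
        = ∑ i, (∑ c, (qualityCore (supp z) hS i c : ℝ) * x (σ c)) ^ 2 :=
          Finset.sum_congr rfl fun i _ => by rw [hreindex]
      _ ≤ 2 ^ 2 * ∑ c, x (σ c) ^ 2 := sum_sq_qualityCore_mulVec_le hS (fun c => x (σ c))
      _ = 2 ^ 2 * ∑ j, x j ^ 2 := by rw [Equiv.sum_comp σ (fun j => x j ^ 2)]
  · have h1 : ∀ i, ∑ j, ((1 : Matrix (Fin m) (Fin m) ℤ) i j : ℝ) * x j = x i := by
      intro i
      rw [Finset.sum_eq_single i]
      · rw [Matrix.one_apply_eq, Int.cast_one, one_mul]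
      · intro j _ hji
        rw [Matrix.one_apply_ne (Ne.symm hji), Int.cast_zero, zero_mul]
      · exact fun h => absurd (Finset.mem_univ i) h
    simp_rw [h1]
    have h0 : 0 ≤ ∑ j, x j ^ 2 := Finset.sum_nonneg fun j _ => sq_nonneg _
    nlinarith

/-- **BLPRS 2013, Claim 4.6: `{0,1}ᵐ` has quality `2`.** For every binary `z` the explicit
`qualityMatrix z` is unimodular, its columns other than the leftmost are orthogonal to `z`, and
`‖(qualityMatrix z) x‖₂ ≤ 2 ‖x‖₂` for all real `x` (not only those with `x₀ = 0`).
[cite: BrakerskiEtAl2013, Claim 4.6] -/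
theorem hasQuality_two_binary [NeZero m] : HasQuality (m := m) 2 {z | ∀ i, z i = 0 ∨ z i = 1} :=
  fun z hz => ⟨qualityMatrix z, isUnit_det_qualityMatrix z,
    fun _ hj => col_qualityMatrix_dotProduct hz hj, fun x _ => sum_sq_qualityMatrix_mulVec_le z x⟩

end BLPRS2013

end Literature.Computability.Cryptography
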